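import Summits.HodgeConjecture.HodgeConjecture.Theorems.K2E1bCDPseudoCoeffDefs        -- ★ leaf (K2E1b-plan (g4) cand, filed K2-defs1 (g4)): `HasFinRankOpTrace`, `IsLeftKFiniteU21`, `hasArchOpTrace_unique`
import Summits.HodgeConjecture.HodgeConjecture.Theorems.K2E1bArchPacketSignsOfParts   -- ★ Q11 p856747: `CDPseudoCoeffWith` (+ `K2E1bArchPacketSignsDefs`: `HasArchOpTrace`, `IsArchTestU21`, `IsRegularParam`, `casimirOf`, `centralOf`)
import Summits.HodgeConjecture.HodgeConjecture.Theorems.K2E1bCubicCasimirDefs         -- ★ D-U8-1 p856708: `SameCubicPin`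
import Summits.HodgeConjecture.HodgeConjecture.Theorems.K2E1bDSClsOfRecord            -- ★ Q9c p856729: `dsClsOfRecord`, `dsCarriersOfRecord` (`dsCarriersOfRecord_cls` is `rfl`)
import Summits.HodgeConjecture.HodgeConjecture.Theorems.K2E1bUnitaryDualOfParts       -- ★ Q12 p857054: `HasChiScalars.of_mk_eq_mk` (χ-pins are class invariants)
import HarnessLib

/-!
# K2 ∕ E1b tier 1 · unit U8e «CD PSEUDO-COEFFICIENT PARTS» — THE FOUR PARTS OF SOCKET 8a AS NAMED STATEMENTS + THE KERNEL-CHECKED COMPOSITION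

Cell hodgecm-mathlib, Track B «K2-LIT», engine E1b; crux item h413 = stmt-HodgeConjecture-24833; dealer ∕ line author K2E1b-plan (g4); filed VERBATIM by the defs desk
K2-defs1 (g4) (K2-lead (g1) CHAIR RULING R19 «8a IN-HOUSE PARTS (LIMITED)», 2026-09-04T05:10:13Z).  Pattern of ★ Q11 `K2E1bArchPacketSignsOfParts` ∕ ★ Q13
`K2E1bUnitaryDualOfPartsCohUnitary`: the statements are `def … : Prop`s HERE (DEFS BEFORE SIGS), the sockets `theorem sig_… : ‹Stmt› := by sorry` live in the Lines module
`Cruxes/H413/Lines/K2_E1b_GKCohomologyU21_U8e_CDPseudoCoeffParts.lean`, their payers prove the unfolded statements in `Theorems/` and are cited BY NAME.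

THE CUT (R19 (2); census `K2/K2E1b-plan/g4/NOTES.K2E1b-plan-g4.md` «8a CENSUS SKETCH»).  Socket 8a of unit U8d,
`sig_K2E1bCDPseudoCoefficient : CDPseudoCoeffWith dsCarriersOfRecord levelBPin` (XL, letter-grade), asks, per Haar measure `ν`, regular `(a,b,c)` and member `j`, for an
archimedean test function `f` with basis-free trace `Θ_ϖ(f) = δ_{ij}` (★ `HasArchOpTrace`) on every unitary globalization `ϖ` of the record class `dsClsOfRecord a b c i`
and `Θ_ϖ(f) = t ≠ 0` on a unitary globalization of a class `x` only if `levelBPin a b c j x` (`x` coh-unitary with the χ-pins `(κ,e)(a,b,c)` and the cubic pin of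
`dsClsOfRecord a b c j`).  It splits into ONE residual in the SHAPE OF THE PRINTED THEOREM and three in-house parts:
* (U8e-3, XL letter-grade, THE residual) `CDPseudoCoeffCoreStmt` — [ClozelDelorme1990, Cor. p. 213 + §5.2 p. 212]: «COROLLAIRE (Existence de pseudo-coefficients). —
  Soit δ₀ ∈ Ĝ_d. Alors, pour tout r > 0, il existe f ∈ C_c^∞(G, K)_r telle que (i) tr δ₀(f) = 1 (ii) tr π_{δ,ν}(f) = 0 pour toute représentation basique π_{δ,ν} de G
  différente de δ₀» (p0022.txt L5–8 of `paper:doi-10-24033-asens-1602`) and «les π_{δ,ν} telles que n(δ, ν) ≠ 0 ont même caractère infinitésimal que π» (p0021.txt L27–30: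
  an irreducible `π` is a ℤ-combination in `R(G)` of basic representations of its own infinitesimal character, so `tr σ(f) ≠ 0`, `σ` irreducible unitary, forces
  inf. char.`(σ)` = inf. char.`(δ₀)`); typed with print's notions: `f` smooth compactly supported (★ `IsArchTestU21`) and LEFT-`K`-finite (★ `IsLeftKFiniteU21` — print
  gives bi-`K`-finite, «K-finies à droite et à gauche», p0003.txt L15–16; the socket asks less), traces = FINITE-RANK traces (★ `HasFinRankOpTrace`), the infinitesimal
  character of `F_{φ(a,b,c)}` in the currency of the line: χ-pins `HasChiScalars · (casimirOf a b c) (centralOf a b c)` on some representative (degree ≤ 2 generators of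
  `Z(𝔤𝔩₃)`) and the RELATIVE cubic pin ★ `SameCubicPin x (dsClsOfRecord a b c j)` (degree 3) [KnappVogan1995, Prop. 4.120];
* (U8e-1, M−, pure Hilbert space) `FinRankTraceHasArchOpTraceStmt` — a finite-rank operator's finite-rank trace is its basis-free trace along EVERY Hilbert basis
  (Parseval; Mathlib `HilbertBasis.hasSum_inner_mul_inner`, `LinearMap.trace_eq_sum_inner`) — brick «8a-1» `Theorems/K2E1bFiniteRankArchOpTrace.lean` (K2-defs1 (g4)),
  head `hasArchOpTrace_of_hasFinRankOpTrace`;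
* (U8e-2, M) `LeftKFiniteFinRankStmt` — for LEFT-`K`-finite `f` and a unitary globalization `ϖ` of a `(𝔤,K)`-class (admissible: ★ `kTypeGrowth_uTwoOne` + ★ E1
  `finiteDimensional_homRangeSum_of_admissible`), `ϖ(f) = ϖ(e_F) ϖ(f)` has finite rank — same brick, head `exists_hasFinRankOpTrace_of_isLeftKFiniteU21`;
* (U8e-4, S–M, ★-adjacent) `GlobalizationCohUnitaryStmt` — a class with a unitary globalization is coh-unitary (some representative is an irreducible ADMISSIBLE
  `(𝔲(2,1),K)`-module unitary along `𝔭 ⊕ ℝz₀`): ★ `isInfUnitary_harishChandra` + ★ `stubT3aUnitaryAlongPOfHermitian_holds` + ★ `isIrreducibleGK_harishChandra_of_isAdmissibleGK`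
  + admissibility (★ `kTypeGrowth_uTwoOne`) + transport along ★ `AreGKEquivalent` (precedent: ★ `isUnitaryGlobalization_clInfChoiceU_of_archIsotypy`, F0P3).
COMPOSITION (§2, PROVED, 0 sorry): `cdPseudoCoeffWith_of_parts : U8e-1 → U8e-2 → U8e-3 → U8e-4 → CDPseudoCoeffWith dsCarriersOfRecord ‹levelBPin›` where ‹levelBPin› is
U8d's support predicate WRITTEN OUT (`fun a b c j x => IsChiPinnedCohUnitary x (casimirOf a b c) (centralOf a b c) ∧ SameCubicPin x (dsClsOfRecord a b c j)`; U8d's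
`def levelBPin` has exactly this body, so U8d ED. 7 pays `sig_K2E1bCDPseudoCoefficient` BY NAME up to `δ`-unfolding).  Glue: the `δ_{ij}` clause is U8e-3 (i) pushed through
U8e-1; the support clause runs BACKWARDS — given `HasArchOpTrace … f t`, U8e-2 gives a finite-rank trace `c`, U8e-1 makes it a basis-free trace, ★ `hasArchOpTrace_unique`
gives `c = t`, so U8e-3 (ii) applies; ★ `HasChiScalars.of_mk_eq_mk` moves the χ-pin onto the coh-unitary representative of U8e-4.
QUANTIFIER CHOICE (R19 (3)): 8a stays AS TYPED — «every unitary globalization» is printed-shaped (`tr π(f)` is a class function; ★ `archOpTrace_eq_of_isUnitaryGlobalization`,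
Harish-Chandra Thm. 8); no R8-twin.
HONEST: this file ISOLATES the XL core of 8a as ONE statement in printed shape and records the kernel-checked assembly; it does NOT remove the core — U8-1 stays OPEN at
8a until U8e-3 is paid (letter-grade named input [ClozelDelorme1990]); no digit of the count moves.

HONEST LABEL: HC_CM is proved only modulo the 7 printed citations (2 remaining named inputs: hLiu418 = stmt-HodgeConjecture-24832,
h413 = stmt-HodgeConjecture-24833) until rung 0 closes; this file asserts nothing beyond the composition (four `def … : Prop` + one proved implication); count-neutral.
-/

set_option autoImplicit false
set_option linter.dupNamespace false

noncomputable section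

open NumberField MeasureTheory CompactlySupported
open scoped Matrix MatrixGroups InnerProductSpace ENNReal

namespace Summit.HodgeConjecture.HodgeConjecture.Cruxes.H413.K2E1bGKCohomologyU21.U8

open Literature.NumberTheory.Automorphic
open Literature.RepresentationTheory.KonnoKonno2007 Literature.RepresentationTheory.KonnoKonno2007.RealDualPair
open Summit.HodgeConjecture.HodgeConjecture.Cruxes.H413.F0P3bArchDegOnePackage (IsCohUnitaryIrrep)
open Summit.HodgeConjecture.HodgeConjecture.Cruxes.H413.K2E1bGKCohomologyU21 (IsChiPinnedCohUnitary HasChiScalars SameCubicPin)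
open Summit.HodgeConjecture.HodgeConjecture.Cruxes.H413.K2E1bDSClsOfRecord (dsClsOfRecord dsCarriersOfRecord)

/-! ## §1 The four parts as named statements -/

/-- **(U8e-1) FINITE-RANK TRACE ⇒ BASIS-FREE TRACE** (M−, pure Hilbert space, at `U(2,1)`): if `ϖ(f)` has finite rank with finite-rank trace `c`
(★ `HasFinRankOpTrace`), then `Σ_k ⟪e_k, ϖ(f) e_k⟫` converges to `c` along EVERY Hilbert basis (★ `HasArchOpTrace`) — Parseval.  Head of brick «8a-1»:
`hasArchOpTrace_of_hasFinRankOpTrace` (generic `G`, `E`), instantiated. (Knapp1986, Thm. 10.2) (ClozelDelorme1990, Cor. p. 213)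
— a route-posited statement of the engine line, not a result of the literature (hence untagged). -/
def FinRankTraceHasArchOpTraceStmt : Prop :=
  ∀ [MeasurableSpace ↥(uFormGroup (Fin 2) (Fin 1)).carrier] [BorelSpace ↥(uFormGroup (Fin 2) (Fin 1)).carrier]
    (ν : Measure ↥(uFormGroup (Fin 2) (Fin 1)).carrier) [ν.IsHaarMeasure]
    (E : Type) [NormedAddCommGroup E] [InnerProductSpace ℂ E] [CompleteSpace E]
    (ϖ : ContRepresentation ℂ ↥(uFormGroup (Fin 2) (Fin 1)).carrier E) (hu : ϖ.IsUnitary) (hsc : ϖ.IsStronglyContinuous)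
    (f : C_c(↥(uFormGroup (Fin 2) (Fin 1)).carrier, ℂ)) (c : ℂ),
    HasFinRankOpTrace ν ϖ hu hsc f c → HasArchOpTrace ν ϖ hu hsc f c

/-- **(U8e-2) LEFT-`K`-FINITE ⇒ FINITE RANK** (M, at `U(2,1)`): for a unitary globalization `ϖ` of a `(𝔤,K)`-class `x` (admissible: ★ `kTypeGrowth_uTwoOne`)
and a LEFT-`K`-finite `f ∈ C_c(U(2,1))` (★ `IsLeftKFiniteU21`), `ϖ(f)` has finite rank, hence a finite-rank trace (★ `HasFinRankOpTrace`) — `ϖ(λ(k) f) = ϖ(k) ϖ(f)`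
for the left-invariant `ν`, so `range ϖ(f)` sits in finitely many `K`-isotypic parts.  Head of brick «8a-1»: `exists_hasFinRankOpTrace_of_isLeftKFiniteU21`.
(BorelWallach2000, 0 §2.5) (ClozelDelorme1990, §1 p. 194) — a route-posited statement of the engine line, not a result of the literature (hence untagged). -/
def LeftKFiniteFinRankStmt : Prop :=
  ∀ (x : GKIrrClass (uFormGroup (Fin 2) (Fin 1)))
    [MeasurableSpace ↥(uFormGroup (Fin 2) (Fin 1)).carrier] [BorelSpace ↥(uFormGroup (Fin 2) (Fin 1)).carrier]
    (ν : Measure ↥(uFormGroup (Fin 2) (Fin 1)).carrier) [ν.IsHaarMeasure]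
    (E : Type) [NormedAddCommGroup E] [InnerProductSpace ℂ E] [CompleteSpace E]
    (ϖ : ContRepresentation ℂ ↥(uFormGroup (Fin 2) (Fin 1)).carrier E) (hϖ : IsUnitaryGlobalization (uFormGroup (Fin 2) (Fin 1)) x ϖ)
    (f : C_c(↥(uFormGroup (Fin 2) (Fin 1)).carrier, ℂ)),
    IsLeftKFiniteU21 f → ∃ c : ℂ, HasFinRankOpTrace ν ϖ hϖ.isUnitary hϖ.isStronglyContinuous f c

/-- **(U8e-3) THE CLOZEL–DELORME CORE IN PRINTED SHAPE** (XL, LETTER-grade — the ONE named printed input of socket 8a): for every Haar measure `ν` on `U(2,1)`,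
regular `(a,b,c)` and member `j`, there is `f ∈ C_c^∞(U(2,1))`, LEFT-`K`-finite, such that (i) on every unitary globalization `ϖ` of the record cell `dsClsOfRecord a b c i`
the finite-rank trace of `ϖ(f)` is `δ_{ij}` («tr δ₀(f) = 1, tr π(f) = 0 pour toute représentation basique … différente de δ₀» — the three cells are discrete series, i.e.
basic, and distinct), and (ii) if `ϖ` is a unitary globalization of a class `x` and `ϖ(f)` has a NON-ZERO finite-rank trace, then `x` has the infinitesimal character of
`F_{φ(a,b,c)}`: χ-pins `(κ, e)(a,b,c) = (casimirOf a b c, centralOf a b c)` on some representative and the cubic pin of `dsClsOfRecord a b c j` («même caractère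
infinitésimal», §5.2 p. 212; `Z(𝔤𝔩₃)` is generated in degrees 1, 2, 3).  TRUE ONLY JOINTLY WITH ★ `lawChi_dsCarriersOfRecord` (the χ-pins of the cells ARE
`(casimirOf, centralOf)`) and ★ `lawDistinct_dsCarriersOfRecord`.  Why it might fail: only by a typing slip (quantifier order ∕ the `K` of ★ `maximalCompact` vs print's
`K`); the mathematics is [ClozelDelorme1990] Thm. 1 ⇒ Cor. (ClozelDelorme1990, Cor. p. 213; §5.2 Prop. 4 p. 212) (Rogawski1990, §13.8 p. 218) (KnappVogan1995, Prop. 4.120)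
— a route-posited statement of the engine line, not a result of the literature (hence untagged). -/
def CDPseudoCoeffCoreStmt : Prop :=
  ∀ [MeasurableSpace ↥(uFormGroup (Fin 2) (Fin 1)).carrier] [BorelSpace ↥(uFormGroup (Fin 2) (Fin 1)).carrier]
    (ν : Measure ↥(uFormGroup (Fin 2) (Fin 1)).carrier) [ν.IsHaarMeasure] (a b c : ℤ), IsRegularParam a b c → ∀ j : Fin 3,
    ∃ f : C_c(↥(uFormGroup (Fin 2) (Fin 1)).carrier, ℂ), IsArchTestU21 f ∧ IsLeftKFiniteU21 f ∧
      (∀ (i : Fin 3) (E : Type) [NormedAddCommGroup E] [InnerProductSpace ℂ E] [CompleteSpace E]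
          (ϖ : ContRepresentation ℂ ↥(uFormGroup (Fin 2) (Fin 1)).carrier E)
          (hϖ : IsUnitaryGlobalization (uFormGroup (Fin 2) (Fin 1)) (dsClsOfRecord a b c i) ϖ),
          HasFinRankOpTrace ν ϖ hϖ.isUnitary hϖ.isStronglyContinuous f (if i = j then 1 else 0)) ∧
      (∀ (x : GKIrrClass (uFormGroup (Fin 2) (Fin 1))) (E : Type) [NormedAddCommGroup E] [InnerProductSpace ℂ E] [CompleteSpace E]
          (ϖ : ContRepresentation ℂ ↥(uFormGroup (Fin 2) (Fin 1)).carrier E)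
          (hϖ : IsUnitaryGlobalization (uFormGroup (Fin 2) (Fin 1)) x ϖ) (t : ℂ),
          HasFinRankOpTrace ν ϖ hϖ.isUnitary hϖ.isStronglyContinuous f t → t ≠ 0 →
            (∃ r : GKIrrep (uFormGroup (Fin 2) (Fin 1)), GKIrrClass.mk r = x ∧ HasChiScalars r.ρ𝔤 (casimirOf a b c) (centralOf a b c)) ∧
              SameCubicPin x (dsClsOfRecord a b c j))

/-- **(U8e-4) A GLOBALIZED CLASS IS COH-UNITARY** (S–M, ★-adjacent): if the `(𝔤,K)`-class `x` of `U(2,1)` has a unitary globalization `ϖ`, then some representative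
of `x` is an irreducible ADMISSIBLE `(𝔲(2,1),K)`-module unitary along `𝔭 ⊕ ℝz₀` (★ `IsCohUnitaryIrrep`): the Harish-Chandra module of `ϖ` is infinitesimally unitary
(★ `isInfUnitary_harishChandra`), hence unitary along `𝔭 ⊕ ℝz₀` (★ `stubT3aUnitaryAlongPOfHermitian_holds`), admissible (★ `kTypeGrowth_uTwoOne`), and these transport
along the `(𝔤,K)`-equivalence of ★ `IsUnitaryGlobalization` to a representative of `x`. (BorelWallach2000, 0 §2.5; II §2.1) (Rogawski1990, Prop. 13.8.1 p. 206)
— a route-posited statement of the engine line, not a result of the literature (hence untagged). -/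
def GlobalizationCohUnitaryStmt : Prop :=
  ∀ (x : GKIrrClass (uFormGroup (Fin 2) (Fin 1))) (E : Type) [NormedAddCommGroup E] [InnerProductSpace ℂ E] [CompleteSpace E]
    (ϖ : ContRepresentation ℂ ↥(uFormGroup (Fin 2) (Fin 1)).carrier E),
    IsUnitaryGlobalization (uFormGroup (Fin 2) (Fin 1)) x ϖ →
      ∃ r : GKIrrep (uFormGroup (Fin 2) (Fin 1)), GKIrrClass.mk r = x ∧ IsCohUnitaryIrrep r.ρK r.ρ𝔤

/-! ## §2 The composition (kernel-checked) -/

/-- **SOCKET 8a FROM ITS FOUR PARTS.**  `CDPseudoCoeffWith dsCarriersOfRecord ‹levelBPin›` (U8d's support predicate written out) follows from U8e-1 … U8e-4: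
the `δ_{ij}` clause is U8e-3 (i) pushed through U8e-1; for the support clause, a basis-free trace `t ≠ 0` of `ϖ(f)` IS the finite-rank trace of `ϖ(f)` (U8e-2 + U8e-1 +
★ `hasArchOpTrace_unique`), so U8e-3 (ii) pins `x`, U8e-4 supplies the coh-unitary representative and ★ `HasChiScalars.of_mk_eq_mk` moves the χ-pin onto it.
[cite: ClozelDelorme1990, Prop. 4, Corollaire] [cite: Knapp1986, Thm. 10.2] [cite: KnappVogan1995, Prop. 4.120] -/
theorem cdPseudoCoeffWith_of_parts (h₁ : FinRankTraceHasArchOpTraceStmt) (h₂ : LeftKFiniteFinRankStmt) (h₃ : CDPseudoCoeffCoreStmt)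
    (h₄ : GlobalizationCohUnitaryStmt) :
    CDPseudoCoeffWith dsCarriersOfRecord
      (fun a b c j x => IsChiPinnedCohUnitary x (casimirOf a b c) (centralOf a b c) ∧ SameCubicPin x (dsClsOfRecord a b c j)) := by
  intro _ _ ν _ a b c habc j
  obtain ⟨f, hf, hK, hδ, hsupp⟩ := h₃ ν a b c habc j
  refine ⟨f, hf, ?_, ?_⟩
  · intro i E _ _ _ ϖ hϖ
    exact h₁ ν E ϖ hϖ.isUnitary hϖ.isStronglyContinuous f _ (hδ i E ϖ hϖ)
  · intro x E _ _ _ ϖ hϖ t ht ht0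
    obtain ⟨c', hc'⟩ := h₂ x ν E ϖ hϖ f hK
    have hct : c' = t :=
      hasArchOpTrace_unique ν ϖ hϖ.isUnitary hϖ.isStronglyContinuous f (h₁ ν E ϖ hϖ.isUnitary hϖ.isStronglyContinuous f c' hc') ht
    subst hct
    obtain ⟨⟨r', hr'x, hchi⟩, hcub⟩ := hsupp x E ϖ hϖ c' hc' ht0
    obtain ⟨r, hrx, hcoh⟩ := h₄ x E ϖ hϖ
    exact ⟨⟨r, hrx, hcoh, hchi.of_mk_eq_mk (hr'x.trans hrx.symm)⟩, hcub⟩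

end Summit.HodgeConjecture.HodgeConjecture.Cruxes.H413.K2E1bGKCohomologyU21.U8
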